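import Summits.ABC.StewartYu.PadicW80NumericL
import HarnessLib

/-!
# The `(log p)`-normalised numerics — part B: the half step in TRUE `log p` form

Support file (theorems only), cell `abc-stewartyu` (p1, stub S5 of memo-03 §4): twin of `PadicW80NumericB.lean` on
the `ℓ`-normalised record at `ℓ = log p`: `halfstep_ineq_one/two` (the two logarithmic inequalities of p3's
`hFinalHalf_of_log_ineq` at `kpts' = 2^{d+J}S₀/2`, for any threshold budget `B ≤ (7/16)·2ᵈ𝔘`), with
`kpts'·t·log p ∈ [(31/32)·2ᵈ𝔘, 2ᵈ𝔘]` and `hL_b·log p ≤ 𝔘/c_L + W⋆ + G` — the landed margins at every `p`.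
[cite: Waldschmidt1980, Lemma 3.7 (pp. 272–273)] [cite: Yu1990, (2.31) (p. 36)]
-/

noncomputable section

open Finset Real
open Literature.NumberTheory.Transcendental Literature.NumberTheory.Transcendental.Waldschmidt1980

namespace Summit.ABC.StewartYu

open PadicW80Par (cTp cSp cLp cLp' Ap mRp condSum_mul_log_le)

namespace PadicW80ParL

variable {d : ℕ} (P : PadicW80ParL d)

omit P in
/-- `log p ≤ p − 1`. [folklore] -/
private theorem log_le_sub_one_nat' {p : ℕ} (hp : 2 ≤ p) : Real.log p ≤ (p : ℝ) - 1 :=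
  Real.log_le_sub_one_of_pos (by exact_mod_cast (by omega : 0 < p))

omit P in
/-- `1 ≤ log p` for `p ≥ 3` (`e < 3`). [folklore] -/
private theorem one_le_log_nat' {p : ℕ} (hp : 3 ≤ p) : (1 : ℝ) ≤ Real.log p := by
  rw [Real.le_log_iff_exp_le (by exact_mod_cast (by omega : 0 < p))]
  have := Real.exp_one_lt_d9
  have h3 : (3 : ℝ) ≤ p := by exact_mod_cast hp
  linarith

/-! ### The half-step inequalities (targets of `hFinalHalf_of_log_ineq`) -/

/-- **Half step, smallness branch (1)**: with `kpts' = 2^{d+J}S₀/2`, `t = t_J`, `ℓ = log p` and any threshold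
budget `B ≤ (7/16)·2ᵈ𝔘`: `(⌊hL_b/(p−1)⌋ + ⌊(t−1)/(p−1)⌋ + cond')·log p + B < U`.
[cite: Waldschmidt1980, Lemma 3.7 (pp. 272–273)] [cite: Yu1990, (2.31) (p. 36)] -/
theorem halfstep_ineq_one {p : ℕ} (hp : 3 ≤ p) (hℓp : P.ℓ = Real.log p) {J : ℕ} (hJ : J < P.J₀ℓ) {B : ℝ}
    (hB : B ≤ 7 / 16 * (2 ^ d * P.𝔘ℓ)) :
    ((P.hparℓ * P.Lbℓ / (p - 1) + (P.tJℓ J - 1) / (p - 1) +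
        ∑ j ∈ range (Nat.log p (2 * (2 ^ (d + J) * P.S₀ℓ / 2))),
          P.tJℓ J * ((2 ^ (d + J) * P.S₀ℓ / 2) / p ^ (j + 1) + 1) : ℕ) : ℝ) * Real.log p + B <
      P.Uℓ := by
  have hp2 : 2 ≤ p := by omega
  have hp1 : (1 : ℝ) < p := by exact_mod_cast (by omega : 1 < p)
  have hlogp1 := one_le_log_nat' hp
  have hlogp0 : 0 ≤ Real.log p := by linarith
  have hlps := log_le_sub_one_nat' hp2
  have hpm1 : (0 : ℝ) < (p : ℝ) - 1 := by linarith
  have hpm2 : (2 : ℝ) ≤ (p : ℝ) - 1 := by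
    have : (3 : ℝ) ≤ p := by exact_mod_cast hp
    linarith
  have hU := P.𝔘_pos; have hW := P.one_le_Wstar; have hWU := P.Wstar_le_𝔘; have hGW := P.G_le_three_Wstar
  have hhLb := P.hparLbℓ_le; have hT := P.T_le_𝔘; have hTpos := P.T_pos
  have hKT := P.KT_le J d
  have htl := P.t_mul_log_kpts_le hJ le_rfl
  have hℓ := P.ℓ_pos
  set kpts : ℕ := 2 ^ (d + J) * P.S₀ℓ / 2 with hkpts
  set t : ℕ := P.tJℓ J with ht
  have hk1 : 1 ≤ kpts := by
    rw [hkpts, Nat.le_div_iff_mul_le two_pos]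
    calc 1 * 2 = 2 := by ring
      _ ≤ 2 ^ (d + J) * 2 := Nat.le_mul_of_pos_left 2 (Nat.pow_pos two_pos)
      _ ≤ 2 ^ (d + J) * P.S₀ℓ := Nat.mul_le_mul_left _ P.two_le_S₀
  have htT : (t : ℝ) ≤ P.Tℓ := by exact_mod_cast P.tJ_le_T J
  have hc1 : ((P.hparℓ * P.Lbℓ / (p - 1) : ℕ) : ℝ) ≤ (P.hparℓ : ℝ) * P.Lbℓ / ((p : ℝ) - 1) := by
    have h := Nat.cast_div_le (α := ℝ) (m := P.hparℓ * P.Lbℓ) (n := p - 1)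
    have e : ((p - 1 : ℕ) : ℝ) = (p : ℝ) - 1 := by rw [Nat.cast_sub (by omega)]; simp
    rw [e] at h; push_cast at h; exact h
  have hc2 : (((t - 1) / (p - 1) : ℕ) : ℝ) ≤ (t : ℝ) / ((p : ℝ) - 1) := by
    have h := Nat.cast_div_le (α := ℝ) (m := t - 1) (n := p - 1)
    have e : ((p - 1 : ℕ) : ℝ) = (p : ℝ) - 1 := by rw [Nat.cast_sub (by omega)]; simp
    rw [e] at h
    have h2 : ((t - 1 : ℕ) : ℝ) ≤ t := by exact_mod_cast Nat.sub_le t 1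
    exact h.trans (div_le_div_of_nonneg_right h2 hpm1.le)
  have hcond := condSum_mul_log_le hp2 kpts t hk1
  have hdiv : ∀ x : ℝ, 0 ≤ x → x / ((p : ℝ) - 1) * Real.log p ≤ x := by
    intro x hx
    rw [div_mul_eq_mul_div, div_le_iff₀ hpm1]
    exact mul_le_mul_of_nonneg_left hlps hx
  have hhLb0 : (0 : ℝ) ≤ (P.hparℓ : ℝ) * P.Lbℓ := by positivity
  have ht0 : (0 : ℝ) ≤ t := Nat.cast_nonneg _
  have hkt0 : (0 : ℝ) ≤ (kpts : ℝ) * t := by positivity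
  -- (a) `⌊hL_b/(p−1)⌋·log p ≤ hL_b·log p ≤ 𝔘/c_L + W⋆ + G`
  have hhLb' : (P.hparℓ : ℝ) * P.Lbℓ * Real.log p ≤ P.𝔘ℓ / cLp + (P.Wstarℓ + P.Gℓ) := by rw [← hℓp]; exact hhLb
  have hA : ((P.hparℓ * P.Lbℓ / (p - 1) : ℕ) : ℝ) * Real.log p ≤ P.𝔘ℓ / cLp + (P.Wstarℓ + P.Gℓ) := by
    have h1 : ((P.hparℓ * P.Lbℓ / (p - 1) : ℕ) : ℝ) * Real.log p ≤ (P.hparℓ : ℝ) * P.Lbℓ / ((p : ℝ) - 1) * Real.log p :=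
      mul_le_mul_of_nonneg_right hc1 hlogp0
    have h2 : (P.hparℓ : ℝ) * P.Lbℓ / ((p : ℝ) - 1) * Real.log p ≤ (P.hparℓ : ℝ) * P.Lbℓ * Real.log p := by
      rw [div_mul_eq_mul_div, div_le_iff₀ hpm1]
      have h00 : (0 : ℝ) ≤ (P.hparℓ : ℝ) * P.Lbℓ * Real.log p := by positivity
      have := mul_le_mul_of_nonneg_left (show (1 : ℝ) ≤ (p : ℝ) - 1 by linarith) h00
      linarith
    linarith
  -- (b) `⌊(t−1)/(p−1)⌋·log p ≤ t`
  have hB' : (((t - 1) / (p - 1) : ℕ) : ℝ) * Real.log p ≤ t :=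
    (mul_le_mul_of_nonneg_right hc2 hlogp0).trans (hdiv _ ht0)
  -- (c) conditioning: `kpts'·t·log p/(p−1) ≤ 2ᵈ𝔘/(p−1) ≤ 2ᵈ𝔘/2`, `t log(2kpts') ≤ 𝔘/128`
  have hktℓ : (kpts : ℝ) * t * Real.log p ≤ 2 ^ d * P.𝔘ℓ := by
    rw [← hℓp]
    have e : 2 ^ d * (P.𝔘ℓ / P.ℓ) * P.ℓ = 2 ^ d * P.𝔘ℓ := by field_simp
    calc (kpts : ℝ) * t * P.ℓ ≤ 2 ^ d * (P.𝔘ℓ / P.ℓ) * P.ℓ := mul_le_mul_of_nonneg_right hKT hℓ.le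
      _ = 2 ^ d * P.𝔘ℓ := e
  have hC : ((∑ j ∈ range (Nat.log p (2 * kpts)), t * (kpts / p ^ (j + 1) + 1) : ℕ) : ℝ) *
      Real.log p ≤ 2 ^ d * P.𝔘ℓ / 2 + P.𝔘ℓ / 128 := by
    refine hcond.trans ?_
    have e3 : (kpts : ℝ) * t * Real.log p / ((p : ℝ) - 1) ≤ 2 ^ d * P.𝔘ℓ / 2 := by
      rw [div_le_iff₀ hpm1]
      have h0 : (0 : ℝ) ≤ 2 ^ d * P.𝔘ℓ := by positivity
      have := mul_le_mul_of_nonneg_left hpm2 h0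
      linarith
    linarith
  have esplit : ((P.hparℓ * P.Lbℓ / (p - 1) + (t - 1) / (p - 1) +
        ∑ j ∈ range (Nat.log p (2 * kpts)), t * (kpts / p ^ (j + 1) + 1) : ℕ) : ℝ) * Real.log p =
      ((P.hparℓ * P.Lbℓ / (p - 1) : ℕ) : ℝ) * Real.log p + (((t - 1) / (p - 1) : ℕ) : ℝ) * Real.log p +
        ((∑ j ∈ range (Nat.log p (2 * kpts)), t * (kpts / p ^ (j + 1) + 1) : ℕ) : ℝ) * Real.log p := by
    push_cast; ring
  rw [esplit, P.U_eq, pow_succ]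
  have h2d : (1 : ℝ) ≤ 2 ^ d := one_le_pow₀ (by norm_num)
  have h5 : P.𝔘ℓ ≤ 2 ^ d * P.𝔘ℓ := by nlinarith
  have e2 : (2 : ℝ) ^ d * 2 * P.𝔘ℓ = 2 * (2 ^ d * P.𝔘ℓ) := by ring
  rw [e2]
  unfold cLp at hA; unfold cTp at hT
  linarith

/-- **Half step, gain branch (2)**: `hL_b·log p + B < (kpts'·t/2)·log p` for `kpts' = 2^{d+J}S₀/2`, `t = t_J`,
`J < J₀`, `ℓ = log p`, and any threshold budget `B ≤ (7/16)·2ᵈ𝔘`.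
[cite: Waldschmidt1980, Lemma 3.7 (pp. 272–273)] [cite: Yu1990, (2.31) (p. 36)] -/
theorem halfstep_ineq_two {p : ℕ} (hp : 3 ≤ p) (hℓp : P.ℓ = Real.log p) {J : ℕ} (hJ : J < P.J₀ℓ) {B : ℝ}
    (hB : B ≤ 7 / 16 * (2 ^ d * P.𝔘ℓ)) :
    ((P.hparℓ * P.Lbℓ : ℕ) : ℝ) * Real.log p + B <
      (((2 ^ (d + J) * P.S₀ℓ / 2) * P.tJℓ J : ℕ) : ℝ) / 2 * Real.log p := by
  have hlogp1 := one_le_log_nat' hp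
  have hU := P.𝔘_pos; have hW := P.one_le_Wstar; have hWU := P.Wstar_le_𝔘; have hGW := P.G_le_three_Wstar
  have hhLb := P.hparLbℓ_le
  have hKT := P.KT_ge hJ d
  have hℓ := P.ℓ_pos
  push_cast at hKT ⊢
  have h2d : (1 : ℝ) ≤ 2 ^ d := one_le_pow₀ (by norm_num)
  have hKTℓ : 31 / 32 * (2 ^ d * P.𝔘ℓ) ≤ (((2 ^ (d + J) * P.S₀ℓ / 2 : ℕ) : ℝ) * (P.tJℓ J : ℝ)) * P.ℓ := by
    have e : 31 / 32 * (2 ^ d * (P.𝔘ℓ / P.ℓ)) * P.ℓ = 31 / 32 * (2 ^ d * P.𝔘ℓ) := by field_simp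
    calc 31 / 32 * (2 ^ d * P.𝔘ℓ) = 31 / 32 * (2 ^ d * (P.𝔘ℓ / P.ℓ)) * P.ℓ := e.symm
      _ ≤ (((2 ^ (d + J) * P.S₀ℓ / 2 : ℕ) : ℝ) * (P.tJℓ J : ℝ)) * P.ℓ := mul_le_mul_of_nonneg_right hKT hℓ.le
  have h5 : P.𝔘ℓ ≤ 2 ^ d * P.𝔘ℓ := by nlinarith
  have key : (P.hparℓ : ℝ) * P.Lbℓ * P.ℓ + 7 / 16 * (2 ^ d * P.𝔘ℓ) < 31 / 32 * (2 ^ d * P.𝔘ℓ) / 2 := by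
    unfold cLp at hhLb; linarith
  rw [← hℓp]
  have h0 : (0 : ℝ) ≤ (P.hparℓ : ℝ) * P.Lbℓ := by positivity
  nlinarith [hKTℓ, key, hB]

end PadicW80ParL

end Summit.ABC.StewartYu

end
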